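import Mathlib

/-!
# Crux `ElementaryWordLength.UnboundedReads` (stmt-ValiantsHypothesis-6627), line `SketchIdeator2` —
# stub `stub_segments`: the generic segment form of an elementary word

A word `w` is a list of letters `(i, j, λ, v)` standing for the elementary matrices
`E_{ij}(λ)` (`v = none`) and `E_{ij}(λ · x_v)` (`v = some v`) of `E₃(ℂ[x_e : e ∈ Fin n × Fin n])`.
Fix block positions `ζ : Fin b → Fin n × Fin n` and let `ℓ` be the number of letters of `w` reading a
block variable (a *block letter*).  The block letters cut `w` into `ℓ + 1` block-free segments.  If a
substitution `S` keeps the block variables and sends every other variable to a constant, every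
substituted block-free segment is a CONSTANT `3 × 3` matrix, while the block letters are unchanged.
Hence the substituted product is obtained from ONE matrix of polynomials
`G₀ · L₁ · G₁ ⋯ L_ℓ · G_ℓ` — `G_t` a generic `3 × 3` matrix of fresh parameter variables (slot `t`),
`L_t` the `t`-th block letter — by evaluating the `9(ℓ+1)` parameters at the entries of the substituted
segments (`stub_segments`, the statement registered in the line skeleton, letters inlined verbatim as
in the route file).  The proof is an induction on the word: a block letter opens a new slot `0` and
shifts the old slots by one (`MvPolynomial.aeval_rename`), a non-block letter is absorbed into slot `0`
(the tail of the generic product does not see slot `0`).  Folklore bookkeeping (Nechiporuk / Kalorkoti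
style "the coefficients are polynomial functions of the segment parameters"); no new definitions.
-/

-- `Summit.ValiantsHypothesis.ValiantsHypothesis.…` is the tree's mandated single-conjunct layout
-- (Sub = Summit), so the duplicated namespace component is intended.
set_option linter.dupNamespace false

open MvPolynomial Matrix

namespace Summit.ValiantsHypothesis.ValiantsHypothesis.Theorems.ElementaryWordLengthUnboundedReads

/-! ## Small matrix / evaluation lemmas -/

/-- A ring hom maps a transvection entrywise to a transvection. [folklore] -/
theorem transvection_map {R R' : Type*} [CommRing R] [CommRing R'] {ι : Type*} [DecidableEq ι]
    (f : R →+* R') (i j : ι) (c : R) :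
    (Matrix.transvection i j c).map f = Matrix.transvection i j (f c) := by
  ext a a'
  simp only [Matrix.transvection, Matrix.map_apply, Matrix.add_apply, Matrix.one_apply,
    Matrix.single_apply, map_add]
  split_ifs <;> simp

/-- `AlgHom.mapMatrix` of a transvection. [folklore] -/
theorem mapMatrix_transvection {R A B : Type*} [CommSemiring R] [CommRing A] [CommRing B]
    [Algebra R A] [Algebra R B] {ι : Type*} [DecidableEq ι] [Fintype ι]
    (f : A →ₐ[R] B) (i j : ι) (c : A) :
    f.mapMatrix (Matrix.transvection i j c) = Matrix.transvection i j (f c) := by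
  rw [AlgHom.mapMatrix_apply]
  exact transvection_map f.toRingHom i j c

section Generic

variable {σ π π' : Type}

/-- Renaming the parameters along `g` and then evaluating them at `x` is evaluating them at
`x ∘ g` (block variables stay variables). [folklore] -/
theorem aeval_param_rename (x : π' → ℂ) (g : π → π') (q : MvPolynomial (σ ⊕ π) ℂ) :
    aeval (Sum.elim X (fun p => C (x p)) : σ ⊕ π' → MvPolynomial σ ℂ) (rename (Sum.map id g) q) =
    aeval (Sum.elim X (fun p => C (x (g p))) : σ ⊕ π → MvPolynomial σ ℂ) q := by
  rw [aeval_rename]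
  have : ((Sum.elim X (fun p => C (x p)) : σ ⊕ π' → MvPolynomial σ ℂ) ∘ Sum.map id g) =
      (Sum.elim X (fun p => C (x (g p))) : σ ⊕ π → MvPolynomial σ ℂ) := by
    funext v
    rcases v with e | p <;> rfl
  rw [this]

/-- Matrix form of `aeval_param_rename`. [folklore] -/
theorem mapMatrix_param_rename (x : π' → ℂ) (g : π → π')
    (T : Matrix (Fin 3) (Fin 3) (MvPolynomial (σ ⊕ π) ℂ)) :
    (aeval (Sum.elim X (fun p => C (x p)) : σ ⊕ π' → MvPolynomial σ ℂ)).mapMatrix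
      (T.map (rename (Sum.map id g))) =
    (aeval (Sum.elim X (fun p => C (x (g p))) : σ ⊕ π → MvPolynomial σ ℂ)).mapMatrix T :=
  Matrix.ext fun a c => by
    simp only [AlgHom.mapMatrix_apply, Matrix.map_apply]
    exact aeval_param_rename x g (T a c)

/-- Parameter evaluation of the generic slot-`t₀` matrix `(X_{(t₀,a,c)})_{a,c}` is the constant matrix
`(x (t₀,a,c))_{a,c}`. [folklore] -/
theorem mapMatrix_param_generic {α : Type} (x : α × Fin 3 × Fin 3 → ℂ) (t₀ : α) :
    (aeval (Sum.elim X (fun p => C (x p)) :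
        σ ⊕ (α × Fin 3 × Fin 3) → MvPolynomial σ ℂ)).mapMatrix
      (Matrix.of fun a c => (X (Sum.inr (t₀, a, c)) : MvPolynomial (σ ⊕ (α × Fin 3 × Fin 3)) ℂ)) =
    (Matrix.of fun a c => x (t₀, a, c)).map C :=
  Matrix.ext fun a c => by simp

end Generic

/-! ## The generic segment form -/

section Segments

variable {n b : ℕ}

/-- **Induction behind `stub_segments`.**  For every word `w` there is a "tail" matrix `T` of
polynomials in the original variables and the parameters of slots `0, …, ℓ` (`ℓ` = number of block
letters of `w`) such that (i) `T` does not see slot `0` (parameter evaluations agreeing off slot `0`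
agree on `T`), and (ii) for every substitution `S` fixing the block variables and constant elsewhere,
the substituted word product is the parameter evaluation of `G₀ · T` (`G₀` the generic slot-`0`
matrix) at some point. [folklore] -/
theorem exists_generic_tail (ζ : Fin b → Fin n × Fin n) :
    ∀ w : List (Fin 3 × Fin 3 × ℂ × Option (Fin n × Fin n)),
    ∃ T : Matrix (Fin 3) (Fin 3) (MvPolynomial ((Fin n × Fin n) ⊕
        (Fin ((w.filter (fun l => decide (∃ i, l.2.2.2 = some (ζ i)))).length + 1) × Fin 3 × Fin 3)) ℂ),
      (∀ x y : Fin ((w.filter (fun l => decide (∃ i, l.2.2.2 = some (ζ i)))).length + 1) × Fin 3 × Fin 3 → ℂ,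
        (∀ t q, x (Fin.succ t, q) = y (Fin.succ t, q)) →
        (aeval (Sum.elim X (fun p => C (x p)) : (Fin n × Fin n) ⊕ _ → MvPolynomial (Fin n × Fin n) ℂ)).mapMatrix T =
        (aeval (Sum.elim X (fun p => C (y p)) : (Fin n × Fin n) ⊕ _ → MvPolynomial (Fin n × Fin n) ℂ)).mapMatrix T) ∧
      ∀ S : Fin n × Fin n → MvPolynomial (Fin n × Fin n) ℂ,
        (∀ i, S (ζ i) = X (ζ i)) → (∀ e, (∀ i, ζ i ≠ e) → ∃ a : ℂ, S e = C a) →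
        ∃ x : Fin ((w.filter (fun l => decide (∃ i, l.2.2.2 = some (ζ i)))).length + 1) × Fin 3 × Fin 3 → ℂ,
          (aeval (Sum.elim X (fun p => C (x p)) : (Fin n × Fin n) ⊕ _ → MvPolynomial (Fin n × Fin n) ℂ)).mapMatrix
            ((Matrix.of fun a c => X (Sum.inr (0, a, c))) * T) =
          (aeval S).mapMatrix ((w.map (fun l => Matrix.transvection l.1 l.2.1
              (MvPolynomial.C l.2.2.1 * l.2.2.2.elim 1 MvPolynomial.X))).prod) := by
  intro w
  induction w with
  | nil =>
    refine ⟨1, fun x y _ => by rw [map_one, map_one], fun S _ _ => ?_⟩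
    refine ⟨fun p => (1 : Matrix (Fin 3) (Fin 3) ℂ) p.2.1 p.2.2, ?_⟩
    rw [mul_one, mapMatrix_param_generic, List.map_nil, List.prod_nil, map_one]
    refine Matrix.ext fun a c => ?_
    simp only [Matrix.map_apply, Matrix.of_apply, Matrix.one_apply]
    split_ifs <;> simp
  | cons l w ih =>
    obtain ⟨T, hTfree, hT⟩ := ih
    by_cases hl : ∃ i, l.2.2.2 = some (ζ i)
    · -- a block letter: new slot `0`, old slots shifted by one
      have hE : (l :: w).filter (fun l => decide (∃ i, l.2.2.2 = some (ζ i))) =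
          l :: w.filter (fun l => decide (∃ i, l.2.2.2 = some (ζ i))) :=
        List.filter_cons_of_pos (by simpa using hl)
      rw [hE]
      obtain ⟨i, hi⟩ := hl
      -- the shifted old generic product, and its independence of slot `0`
      have key : ∀ z : Fin ((l :: w.filter (fun l => decide (∃ i, l.2.2.2 = some (ζ i)))).length + 1) ×
          Fin 3 × Fin 3 → ℂ,
          (aeval (Sum.elim X (fun p => C (z p)) : (Fin n × Fin n) ⊕ _ →
              MvPolynomial (Fin n × Fin n) ℂ)).mapMatrix
            (((Matrix.of fun a c => X (Sum.inr (0, a, c))) * T).map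
              (rename (Sum.map id (fun p : Fin _ × Fin 3 × Fin 3 => (p.1.succ, p.2))))) =
          (aeval (Sum.elim X (fun p => C (z (p.1.succ, p.2))) : (Fin n × Fin n) ⊕ _ →
              MvPolynomial (Fin n × Fin n) ℂ)).mapMatrix
            ((Matrix.of fun a c => X (Sum.inr (0, a, c))) * T) :=
        fun z => mapMatrix_param_rename z _ _
      refine ⟨Matrix.transvection l.1 l.2.1 (C l.2.2.1 * X (Sum.inl (ζ i))) *
          ((Matrix.of fun a c => X (Sum.inr (0, a, c))) * T).map
            (rename (Sum.map id (fun p : Fin _ × Fin 3 × Fin 3 => (p.1.succ, p.2)))), ?_, ?_⟩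
      · intro x y hxy
        have hfun : (fun p : Fin ((w.filter (fun l => decide (∃ i, l.2.2.2 = some (ζ i)))).length + 1) ×
            Fin 3 × Fin 3 => (C (x (p.1.succ, p.2)) : MvPolynomial (Fin n × Fin n) ℂ)) =
            fun p => C (y (p.1.succ, p.2)) := funext fun p => by rw [hxy p.1 p.2]
        rw [map_mul, map_mul, mapMatrix_transvection, mapMatrix_transvection, key x, key y, hfun]
        congr 1
        simp
      · intro S hS₁ hS₂
        obtain ⟨x', hx'⟩ := hT S hS₁ hS₂
        set x : Fin ((l :: w.filter (fun l => decide (∃ i, l.2.2.2 = some (ζ i)))).length + 1) ×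
            Fin 3 × Fin 3 → ℂ :=
          fun p => Fin.cases (motive := fun _ => ℂ) ((1 : Matrix (Fin 3) (Fin 3) ℂ) p.2.1 p.2.2)
            (fun t => x' (t, p.2)) p.1 with hxdef
        have hx0 : ∀ a c, x (0, a, c) = (1 : Matrix (Fin 3) (Fin 3) ℂ) a c := fun a c => by
          simp [hxdef]
        have hxs : (fun p : Fin ((w.filter (fun l => decide (∃ i, l.2.2.2 = some (ζ i)))).length + 1) ×
            Fin 3 × Fin 3 => (C (x (p.1.succ, p.2)) : MvPolynomial (Fin n × Fin n) ℂ)) =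
            fun p => C (x' p) := by
          funext p
          simp [hxdef]
        refine ⟨x, ?_⟩
        have h1 : (aeval (Sum.elim X (fun p => C (x p)) : (Fin n × Fin n) ⊕ _ →
            MvPolynomial (Fin n × Fin n) ℂ)).mapMatrix (Matrix.of fun a c =>
              (X (Sum.inr (0, a, c)) : MvPolynomial ((Fin n × Fin n) ⊕
                (Fin ((l :: w.filter (fun l => decide (∃ i, l.2.2.2 = some (ζ i)))).length + 1) ×
                  Fin 3 × Fin 3)) ℂ)) = 1 := by
          rw [mapMatrix_param_generic]
          refine Matrix.ext fun a c => ?_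
          simp only [Matrix.map_apply, Matrix.of_apply, hx0, Matrix.one_apply]
          split_ifs <;> simp
        have h2 : (aeval (Sum.elim X (fun p => C (x p)) : (Fin n × Fin n) ⊕ _ →
            MvPolynomial (Fin n × Fin n) ℂ)).mapMatrix
              (Matrix.transvection l.1 l.2.1 (C l.2.2.1 * X (Sum.inl (ζ i)))) =
            (aeval S).mapMatrix (Matrix.transvection l.1 l.2.1
              (MvPolynomial.C l.2.2.1 * l.2.2.2.elim 1 MvPolynomial.X)) := by
          rw [mapMatrix_transvection, mapMatrix_transvection, hi]
          simp [hS₁]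
        simp only [List.map_cons, List.prod_cons, map_mul]
        rw [← hx', h1, one_mul, h2, key x, hxs]
    · -- a non-block letter: absorbed into slot `0`
      have hE : (l :: w).filter (fun l => decide (∃ i, l.2.2.2 = some (ζ i))) =
          w.filter (fun l => decide (∃ i, l.2.2.2 = some (ζ i))) :=
        List.filter_cons_of_neg (by simpa using hl)
      rw [hE]
      refine ⟨T, hTfree, fun S hS₁ hS₂ => ?_⟩
      obtain ⟨x', hx'⟩ := hT S hS₁ hS₂
      -- the substituted letter is a constant matrix `N`
      obtain ⟨N, hN⟩ : ∃ N : Matrix (Fin 3) (Fin 3) ℂ,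
          (aeval S).mapMatrix (Matrix.transvection l.1 l.2.1
            (MvPolynomial.C l.2.2.1 * l.2.2.2.elim 1 MvPolynomial.X)) = N.map C := by
        rw [mapMatrix_transvection]
        rcases hv : l.2.2.2 with _ | e
        · exact ⟨Matrix.transvection l.1 l.2.1 l.2.2.1, by
            rw [transvection_map]; simp⟩
        · obtain ⟨a, ha⟩ := hS₂ e (fun i h => hl ⟨i, by rw [hv, h]⟩)
          exact ⟨Matrix.transvection l.1 l.2.1 (l.2.2.1 * a), by
            rw [transvection_map]; simp [ha]⟩
      set x : Fin ((w.filter (fun l => decide (∃ i, l.2.2.2 = some (ζ i)))).length + 1) ×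
          Fin 3 × Fin 3 → ℂ :=
        fun p => Fin.cases (motive := fun _ => ℂ)
          ((N * (Matrix.of fun a c => x' (0, a, c)) : Matrix (Fin 3) (Fin 3) ℂ) p.2.1 p.2.2)
          (fun t => x' (t.succ, p.2)) p.1 with hxdef
      have hx0 : ∀ a c, x (0, a, c) = (N * (Matrix.of fun a c => x' (0, a, c)) :
          Matrix (Fin 3) (Fin 3) ℂ) a c := fun a c => by
        simp only [hxdef, Fin.cases_zero]
      have hxs : ∀ t q, x (Fin.succ t, q) = x' (Fin.succ t, q) := fun t q => by
        simp only [hxdef, Fin.cases_succ]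
      refine ⟨x, ?_⟩
      have hG : (aeval (Sum.elim X (fun p => C (x p)) : (Fin n × Fin n) ⊕ _ →
            MvPolynomial (Fin n × Fin n) ℂ)).mapMatrix (Matrix.of fun a c =>
              (X (Sum.inr (0, a, c)) : MvPolynomial ((Fin n × Fin n) ⊕
                (Fin ((w.filter (fun l => decide (∃ i, l.2.2.2 = some (ζ i)))).length + 1) ×
                  Fin 3 × Fin 3)) ℂ)) =
          N.map C * (aeval (Sum.elim X (fun p => C (x' p)) : (Fin n × Fin n) ⊕ _ →
            MvPolynomial (Fin n × Fin n) ℂ)).mapMatrix (Matrix.of fun a c =>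
              (X (Sum.inr (0, a, c)) : MvPolynomial ((Fin n × Fin n) ⊕
                (Fin ((w.filter (fun l => decide (∃ i, l.2.2.2 = some (ζ i)))).length + 1) ×
                  Fin 3 × Fin 3)) ℂ)) := by
        rw [mapMatrix_param_generic, mapMatrix_param_generic, ← Matrix.map_mul]
        congr 1
      simp only [List.map_cons, List.prod_cons, map_mul]
      rw [← hx', map_mul, hN, hTfree x x' hxs, hG, mul_assoc]

/-- **Stub `stub_segments` of line `SketchIdeator2` (crux `UnboundedReads`, stmt-ValiantsHypothesis-6627):
the generic segment form.**  For a word `w` and block positions `ζ : Fin b → Fin n × Fin n` with `ℓ`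
block letters there is a polynomial `D` in the original variables and `(ℓ+1)·3·3` parameters such that
for every substitution `S` fixing the block variables and constant elsewhere, the `(0,2)` entry of the
substituted word product is a parameter evaluation of `D`. [folklore] -/
theorem stub_segments :
    ∀ (n b : ℕ) (ζ : Fin b → Fin n × Fin n) (w : List (Fin 3 × Fin 3 × ℂ × Option (Fin n × Fin n))),
    ∃ D : MvPolynomial ((Fin n × Fin n) ⊕
        (Fin ((w.filter (fun l => decide (∃ i, l.2.2.2 = some (ζ i)))).length + 1) × Fin 3 × Fin 3)) ℂ,
      ∀ S : Fin n × Fin n → MvPolynomial (Fin n × Fin n) ℂ,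
        (∀ i, S (ζ i) = MvPolynomial.X (ζ i)) →
        (∀ e, (∀ i, ζ i ≠ e) → ∃ a : ℂ, S e = MvPolynomial.C a) →
        ∃ x : Fin ((w.filter (fun l => decide (∃ i, l.2.2.2 = some (ζ i)))).length + 1) × Fin 3 × Fin 3 → ℂ,
          MvPolynomial.aeval (Sum.elim MvPolynomial.X (fun p => MvPolynomial.C (x p))) D =
            MvPolynomial.aeval S (((w.map (fun l => Matrix.transvection l.1 l.2.1
              (MvPolynomial.C l.2.2.1 * l.2.2.2.elim 1 MvPolynomial.X))).prod) 0 2) := by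
  intro n b ζ w
  obtain ⟨T, _, hT⟩ := exists_generic_tail ζ w
  refine ⟨((Matrix.of fun a c => X (Sum.inr (0, a, c))) * T : Matrix (Fin 3) (Fin 3) _) 0 2,
    fun S hS₁ hS₂ => ?_⟩
  obtain ⟨x, hx⟩ := hT S hS₁ hS₂
  refine ⟨x, ?_⟩
  have := congr_fun (congr_fun hx 0) 2
  simpa only [AlgHom.mapMatrix_apply, Matrix.map_apply] using this

end Segments

end Summit.ValiantsHypothesis.ValiantsHypothesis.Theorems.ElementaryWordLengthUnboundedReads
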